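import Mathlib.LinearAlgebra.Matrix.Rank
import Mathlib.LinearAlgebra.FiniteDimensional.Lemmas
import Mathlib.Data.Fin.Tuple.Basic
import Mathlib.Tactic
import HarnessLib

/-!
# A rank-`q` combination of the slices of the Coppersmith–Winograd decomposition (Alman–Li 2026, Lemma 7.1)

Topic `Literature/Computability/AlgebraicComplexity` (family `MatrixMultiplication`). Source: J. Alman,
B. Li, *Asymptotic Rank Speedup Theorems, Revisited*, arXiv:2605.21738 (2026), §7.1, Lemma 7.1 with
its printed proof (held text `paper:arxiv-2605.21738`, p0017 L29–61).

## The printed statement and proof (p0017)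

"**Lemma 7.1.** Let `aᵢ, bᵢ, cᵢ` be the data of the border-rank upper bound `cw_q ⊴ ⟨q+2⟩` given
above [`∑_{i=1}^q λ^{-2}(x₀+λxᵢ)(y₀+λyᵢ)(z₀+λzᵢ) − λ^{-3}(x₀+λ²∑xᵢ)(y₀+λ²∑yᵢ)(z₀+λ²∑zᵢ)
+ (λ^{-3} − qλ^{-2}) x₀y₀z₀ = cw_q + O(λ)`]. Then there exist nonzero scalars `cᵢ'` such that the
matrix `M = ∑_{i=1}^{q+2} cᵢ' · aᵢ bᵢ ∈ U' ⊗ V'` has rank `q`.  *Proof.* … apply the change of basis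
`xᵢ' := x₀ + λxᵢ` … `M = c₀' x₀y₀ + ∑ cᵢ' xᵢ'yᵢ' + c'_{q+1}((1−qλ)x₀ + λ∑xᵢ')((1−qλ)y₀ + λ∑yᵢ')`.
Assume `cᵢ' = 1` for all `i ≤ q`. We choose `c'_{q+1}` so that `M` becomes singular. Writing `M` in
the form `M = I + c'_{q+1} abᵀ`, we have `det(M) = 1 + c'_{q+1} bᵀa`, and a direct calculation gives
`bᵀa = (1−qλ)² + qλ² ≠ 0`. Taking `c'_{q+1} = −1/(bᵀa)` yields `Rk(M) < q+1`. On the other hand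
`Rk(M) ≥ Rk(I) − Rk(c'_{q+1}abᵀ) = q`. Therefore, this choice produces a rank-`q` matrix."

## The form proved here (coordinates; any field `L`, `λ ↦ t ∈ L`)

The `U`- and `V`-vectors of the `q + 2` triads, indexed as in the tree's explicit CW degeneration
(`BorderRankCWDischarge.lean`, `exists_isApproxDecomposition_three_cwTensor`: `q` small triads, then
the big one, then `x₀y₀z₀`; up to the scalar factors `λ, −1, 1 − qλ` carried there by the first
vector, which are absorbed into the `cᵢ'`), with `λ` specialised to an element `t` of a field `L`
(for the application, `L = K(λ)` and `t = λ`): `vᵢ = x₀ + t xᵢ₊₁` (`i < q`), `v_q = x₀ + t² ∑ⱼ xⱼ₊₁`,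
`v_{q+1} = x₀`, written inline with `Fin.append` / `Fin.cases` exactly as in that file; coefficients
`c' = (1, …, 1, −1/β, 1)`, `β = (1 − qt)² + qt²`.

* `AlmanLi2026.lemma71_rank_le` — if `β ≠ 0`, the matrix `M = ∑ᵢ cᵢ' vᵢ vᵢᵀ` has rank `≤ q`
  (the half of the printed "rank `q`" that the speedup theorem consumes: Thm. 6.1's hypothesis is
  "`M` has rank at most `s`"). Printed proof: `M = P (I − β⁻¹ a aᵀ) Pᵀ` with `P` the change of basis
  `x₀, x₁', …, x_q'` and `a = (1 − qt, t, …, t)`, and `(I − β⁻¹ a aᵀ) a = 0` with `a ≠ 0`.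
* `AlmanLi2026.lemma71_coeff_ne_zero` — the `cᵢ'` are all nonzero ("nonzero scalars").

* `AlmanLi2026.lemma71_rank_ge`, `AlmanLi2026.lemma71_rank_eq` — for `t ≠ 0` the rank is `≥ q`,
  hence `= q` as printed (the printed lower bound "`Rk(M) = Rk(I + c'abᵀ) ≥ Rk(I) − Rk(c'abᵀ) = q`":
  here `M + β⁻¹ w wᵀ = P Pᵀ` with `P` upper triangular of determinant `t^q`, `w = v_q`).

No new definitions, no named facts.

## References

* J. Alman, B. Li, *Asymptotic Rank Speedup Theorems, Revisited*, arXiv:2605.21738 (2026), Lemma 7.1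
  (p0017). [AlmanLi2026]
-/

noncomputable section

open scoped BigOperators Matrix

namespace Literature.Computability.AlgebraicComplexity

namespace AlmanLi2026

variable {L : Type*} [Field L]

/-- **Alman–Li 2026, Lemma 7.1 (the coefficients are nonzero)**: with `β = (1 − qt)² + qt² ≠ 0` the
scalars `c' = (1, …, 1, −β⁻¹, 1)` are all nonzero. [cite: AlmanLi2026, Lemma 7.1] -/
theorem lemma71_coeff_ne_zero (q : ℕ) (t : L)
    (hβ : (1 - (q : L) * t) ^ 2 + (q : L) * t ^ 2 ≠ 0) (i : Fin (q + 2)) :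
    Fin.append (fun _ : Fin q => (1 : L)) ![-((1 - (q : L) * t) ^ 2 + (q : L) * t ^ 2)⁻¹, 1] i
      ≠ 0 := by
  refine Fin.addCases (fun i => ?_) (fun j => ?_) i
  · rw [Fin.append_left]; exact one_ne_zero
  · rw [Fin.append_right]
    fin_cases j
    · simpa using hβ
    · simp

/-- **Alman–Li 2026, Lemma 7.1 (rank at most `q`)**, coordinates over any field `L` with `λ ↦ t`:
for the `U`- and `V`-vectors `vᵢ = x₀ + t xᵢ₊₁` (`i < q`), `v_q = x₀ + t²∑ⱼxⱼ₊₁`, `v_{q+1} = x₀` of the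
Coppersmith–Winograd decomposition of `cw_q` and `c' = (1,…,1,−β⁻¹,1)`, `β = (1−qt)² + qt² ≠ 0`,
the matrix `M = ∑ᵢ cᵢ' vᵢvᵢᵀ` has rank at most `q` (printed: `M = I + c'abᵀ` in the basis
`x₀, xᵢ' = x₀ + t xᵢ`, singular for `c' = −1/(bᵀa)`). [cite: AlmanLi2026, Lemma 7.1] -/
theorem lemma71_rank_le (q : ℕ) (t : L) (hβ : (1 - (q : L) * t) ^ 2 + (q : L) * t ^ 2 ≠ 0) :
    (Matrix.of fun r s : Fin (q + 1) =>
      ∑ i : Fin (q + 2),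
        Fin.append (fun _ : Fin q => (1 : L)) ![-((1 - (q : L) * t) ^ 2 + (q : L) * t ^ 2)⁻¹, 1] i *
          Fin.append (fun i : Fin q =>
              (Fin.cases 1 (fun r => if r = i then t else 0) : Fin (q + 1) → L))
            ![Fin.cases 1 (fun _ => t ^ 2), Fin.cases 1 (fun _ => 0)] i r *
          Fin.append (fun i : Fin q =>
              (Fin.cases 1 (fun r => if r = i then t else 0) : Fin (q + 1) → L))
            ![Fin.cases 1 (fun _ => t ^ 2), Fin.cases 1 (fun _ => 0)] i s).rank ≤ q := by
  classical
  set β : L := (1 - (q : L) * t) ^ 2 + (q : L) * t ^ 2 with hβdef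
  set vs : Fin q → Fin (q + 1) → L := fun i => Fin.cases 1 (fun r => if r = i then t else 0)
    with hvs
  set w : Fin (q + 1) → L := Fin.cases 1 (fun _ => t ^ 2) with hw
  set e₀ : Fin (q + 1) → L := Fin.cases 1 (fun _ => 0) with he₀
  -- the change of basis `P = [x₀ | x₁' | … | x_q']` and the vector `a = (1 − qt, t, …, t)`
  set P : Matrix (Fin (q + 1)) (Fin (q + 1)) L :=
    Matrix.of fun r j => (Fin.cases (e₀ r) (fun i => vs i r) j : L) with hP
  set a : Fin (q + 1) → L := Fin.cases (1 - (q : L) * t) (fun _ => t) with ha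
  set N : Matrix (Fin (q + 1)) (Fin (q + 1)) L :=
    Matrix.of fun j l => (if j = l then (1 : L) else 0) + -β⁻¹ * (a j * a l) with hN
  -- entries of `M`: split the sum over `Fin (q + 2) = Fin q ⊕ Fin 2`
  have hM : ∀ r s : Fin (q + 1), (∑ i : Fin (q + 2),
      Fin.append (fun _ : Fin q => (1 : L)) ![-β⁻¹, 1] i *
        Fin.append vs ![w, e₀] i r * Fin.append vs ![w, e₀] i s) =
      (∑ i : Fin q, vs i r * vs i s) + -β⁻¹ * (w r * w s) + e₀ r * e₀ s := by
    intro r s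
    rw [Fin.sum_univ_add, Fin.sum_univ_two]
    simp only [Fin.append_left, Fin.append_right, Matrix.cons_val_zero, Matrix.cons_val_one,
      one_mul]
    ring
  -- `∑_j P r j a_j = w r` (the big vector in the new basis: `v_q = (1 − qt)x₀ + t ∑ xᵢ'`)
  have hPa : ∀ r, (∑ j, P r j * a j) = w r := by
    intro r
    rw [Fin.sum_univ_succ]
    simp only [hP, Matrix.of_apply, Fin.cases_zero, Fin.cases_succ, ha]
    refine Fin.cases ?_ (fun r' => ?_) r
    · simp only [he₀, hvs, hw, Fin.cases_zero, one_mul, Finset.sum_const, Finset.card_univ,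
        Fintype.card_fin, nsmul_eq_mul]
      ring
    · simp only [he₀, hvs, hw, Fin.cases_succ, zero_mul, zero_add]
      rw [Finset.sum_eq_single r' (fun i _ hi => by simp [Ne.symm hi]) (by simp)]
      simp
      ring
  -- `∑_j P r j P s j = e₀ r e₀ s + ∑ᵢ vᵢ r vᵢ s`
  have hPP : ∀ r s, (∑ j, P r j * P s j) = e₀ r * e₀ s + ∑ i : Fin q, vs i r * vs i s := by
    intro r s
    rw [Fin.sum_univ_succ]
    simp only [hP, Matrix.of_apply, Fin.cases_zero, Fin.cases_succ]
  -- `M = P N Pᵀ`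
  have hfact : (Matrix.of fun r s : Fin (q + 1) => ∑ i : Fin (q + 2),
      Fin.append (fun _ : Fin q => (1 : L)) ![-β⁻¹, 1] i *
        Fin.append vs ![w, e₀] i r * Fin.append vs ![w, e₀] i s) = P * N * Pᵀ := by
    ext r s
    rw [Matrix.of_apply, hM r s, Matrix.mul_apply]
    have hPN : ∀ l, (P * N) r l = P r l + -β⁻¹ * w r * a l := by
      intro l
      rw [Matrix.mul_apply]
      simp only [hN, Matrix.of_apply, mul_add, Finset.sum_add_distrib, mul_ite, mul_one, mul_zero,
        Finset.sum_ite_eq', Finset.mem_univ, if_true]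
      rw [← hPa r]
      simp only [Finset.sum_mul, Finset.mul_sum]
      refine congrArg _ (Finset.sum_congr rfl fun j _ => ?_)
      ring
    simp only [hPN, Matrix.transpose_apply, add_mul, Finset.sum_add_distrib]
    rw [hPP r s]
    have h2 : (∑ l, -β⁻¹ * w r * a l * P s l) = -β⁻¹ * (w r * w s) := by
      rw [← hPa s, Finset.mul_sum, Finset.mul_sum]
      refine Finset.sum_congr rfl fun l _ => ?_
      ring
    rw [h2]
    ring
  -- `N a = 0` with `a ≠ 0`, so `rank N ≤ q`
  have haa : (∑ l, a l * a l) = β := by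
    rw [Fin.sum_univ_succ]
    simp only [ha, Fin.cases_zero, Fin.cases_succ, Finset.sum_const, Finset.card_univ,
      Fintype.card_fin, nsmul_eq_mul, hβdef]
    ring
  have hNa : N.mulVec a = 0 := by
    funext j
    rw [Matrix.mulVec, dotProduct, Pi.zero_apply]
    simp only [hN, Matrix.of_apply, add_mul, Finset.sum_add_distrib, ite_mul, one_mul, zero_mul,
      Finset.sum_ite_eq, Finset.mem_univ, if_true]
    have h3 : (∑ l, -β⁻¹ * (a j * a l) * a l) = -β⁻¹ * a j * ∑ l, a l * a l := by
      rw [Finset.mul_sum]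
      refine Finset.sum_congr rfl fun l _ => ?_
      ring
    rw [h3, haa]
    field_simp
    ring
  have ha0 : a ≠ 0 := by
    intro h0
    by_cases h1 : (1 - (q : L) * t) = 0
    · -- then `q ≠ 0` and `t ≠ 0`, and the coordinate `a₁ = t` vanishes: contradiction
      have hq : q ≠ 0 := by
        rintro rfl
        simp at h1
      have ht : t ≠ 0 := by
        rintro rfl
        simp at h1
      obtain ⟨q', rfl⟩ := Nat.exists_eq_succ_of_ne_zero hq
      have := congrFun h0 (Fin.succ 0)
      simp only [ha, Fin.cases_succ, Pi.zero_apply] at this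
      exact ht this
    · have := congrFun h0 0
      simp only [ha, Fin.cases_zero, Pi.zero_apply] at this
      exact h1 this
  have hrankN : N.rank ≤ q := by
    have hker : 0 < Module.finrank L (LinearMap.ker N.mulVecLin) := by
      rw [Module.finrank_pos_iff_exists_ne_zero]
      refine ⟨⟨a, ?_⟩, ?_⟩
      · rw [LinearMap.mem_ker, Matrix.mulVecLin_apply, hNa]
      · intro h
        apply ha0
        exact congrArg Subtype.val h
    have hrn := LinearMap.finrank_range_add_finrank_ker N.mulVecLin
    rw [Module.finrank_fintype_fun_eq_card, Fintype.card_fin] at hrn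
    change Module.finrank L (LinearMap.range N.mulVecLin) ≤ q
    omega
  -- conclude: `rank M = rank (P N Pᵀ) ≤ rank (P N) ≤ rank N ≤ q`
  rw [hfact]
  exact ((Matrix.rank_mul_le_left _ _).trans (Matrix.rank_mul_le_right _ _)).trans hrankN

/-- Sub-additivity of the rank of matrices over a field, `Rk(A + B) ≤ Rk(A) + Rk(B)` (a private copy
of the tree's `matrix_rank_add_le` of `RankMethodBarriers.lean`, which this file does not import).
[folklore] -/
private theorem rank_add_le₇₁ {m n : Type*} [Fintype n] (A B : Matrix m n L) :
    (A + B).rank ≤ A.rank + B.rank := by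
  unfold Matrix.rank
  rw [Matrix.mulVecLin_add]
  calc Module.finrank L ↥(LinearMap.range (A.mulVecLin + B.mulVecLin))
      ≤ Module.finrank L ↥(LinearMap.range A.mulVecLin ⊔ LinearMap.range B.mulVecLin) :=
        Submodule.finrank_mono (LinearMap.range_add_le _ _)
    _ ≤ _ := Submodule.finrank_add_le_finrank_add_finrank _ _

/-- **Alman–Li 2026, Lemma 7.1 (rank at least `q`)** — the other half of the printed "the matrix
`M = ∑ cᵢ' · aᵢbᵢ` has rank `q`" (printed proof, p0017 L57–60: "`Rk(M) = Rk(I + c'_{q+1}abᵀ) ≥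
Rk(I) − Rk(c'_{q+1}abᵀ) = q`"), in the coordinates of `lemma71_rank_le` and for `t ≠ 0` (in print `λ`
is an indeterminate; at `t = 0` all the `vᵢ` collapse to `x₀`): with `P = [x₀ | x₁' | … | x_q']`
(upper triangular, diagonal `(1, t, …, t)`, so `det P = t^q ≠ 0`) and `w = v_q` one has
`M + β⁻¹ w wᵀ = P Pᵀ` (the printed `I` in the basis `x₀, xᵢ'`), hence
`q + 1 = Rk(P Pᵀ) ≤ Rk(M) + Rk(β⁻¹ w wᵀ) ≤ Rk(M) + 1`. [cite: AlmanLi2026, Lemma 7.1] -/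
theorem lemma71_rank_ge (q : ℕ) (t : L) (ht : t ≠ 0) :
    q ≤ (Matrix.of fun r s : Fin (q + 1) =>
      ∑ i : Fin (q + 2),
        Fin.append (fun _ : Fin q => (1 : L)) ![-((1 - (q : L) * t) ^ 2 + (q : L) * t ^ 2)⁻¹, 1] i *
          Fin.append (fun i : Fin q =>
              (Fin.cases 1 (fun r => if r = i then t else 0) : Fin (q + 1) → L))
            ![Fin.cases 1 (fun _ => t ^ 2), Fin.cases 1 (fun _ => 0)] i r *
          Fin.append (fun i : Fin q =>
              (Fin.cases 1 (fun r => if r = i then t else 0) : Fin (q + 1) → L))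
            ![Fin.cases 1 (fun _ => t ^ 2), Fin.cases 1 (fun _ => 0)] i s).rank := by
  classical
  set β : L := (1 - (q : L) * t) ^ 2 + (q : L) * t ^ 2 with hβdef
  set vs : Fin q → Fin (q + 1) → L := fun i => Fin.cases 1 (fun r => if r = i then t else 0)
    with hvs
  set w : Fin (q + 1) → L := Fin.cases 1 (fun _ => t ^ 2) with hw
  set e₀ : Fin (q + 1) → L := Fin.cases 1 (fun _ => 0) with he₀
  -- the change of basis `P = [x₀ | x₁' | … | x_q']`
  set P : Matrix (Fin (q + 1)) (Fin (q + 1)) L :=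
    Matrix.of fun r j => (Fin.cases (e₀ r) (fun i => vs i r) j : L) with hP
  -- entries of `M`: split the sum over `Fin (q + 2) = Fin q ⊕ Fin 2`
  have hM : ∀ r s : Fin (q + 1), (∑ i : Fin (q + 2),
      Fin.append (fun _ : Fin q => (1 : L)) ![-β⁻¹, 1] i *
        Fin.append vs ![w, e₀] i r * Fin.append vs ![w, e₀] i s) =
      (∑ i : Fin q, vs i r * vs i s) + -β⁻¹ * (w r * w s) + e₀ r * e₀ s := by
    intro r s
    rw [Fin.sum_univ_add, Fin.sum_univ_two]
    simp only [Fin.append_left, Fin.append_right, Matrix.cons_val_zero, Matrix.cons_val_one,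
      one_mul]
    ring
  -- `∑_j P r j P s j = e₀ r e₀ s + ∑ᵢ vᵢ r vᵢ s`
  have hPP : ∀ r s, (∑ j, P r j * P s j) = e₀ r * e₀ s + ∑ i : Fin q, vs i r * vs i s := by
    intro r s
    rw [Fin.sum_univ_succ]
    simp only [hP, Matrix.of_apply, Fin.cases_zero, Fin.cases_succ]
  -- `M + β⁻¹ w wᵀ = P Pᵀ` (the printed `I`, transported to the original coordinates)
  have hfact : (Matrix.of fun r s : Fin (q + 1) => ∑ i : Fin (q + 2),
      Fin.append (fun _ : Fin q => (1 : L)) ![-β⁻¹, 1] i *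
        Fin.append vs ![w, e₀] i r * Fin.append vs ![w, e₀] i s) +
      β⁻¹ • Matrix.vecMulVec w w = P * Pᵀ := by
    ext r s
    rw [Matrix.add_apply, Matrix.of_apply, hM r s, Matrix.mul_apply, Matrix.smul_apply,
      Matrix.vecMulVec_apply, smul_eq_mul]
    simp only [Matrix.transpose_apply]
    rw [hPP r s]
    ring
  -- `P` is upper triangular with diagonal `(1, t, …, t)`
  have hPtri : P.BlockTriangular id := by
    intro i j hij
    change j < i at hij
    simp only [hP, Matrix.of_apply]
    cases j using Fin.cases with
    | zero =>
      obtain ⟨i', rfl⟩ := Fin.exists_succ_eq.mpr hij.ne'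
      simp only [Fin.cases_zero, he₀, Fin.cases_succ]
    | succ j' =>
      obtain ⟨i', rfl⟩ := Fin.exists_succ_eq.mpr ((Fin.succ_pos j').trans hij).ne'
      have hne : i' ≠ j' := (Fin.succ_lt_succ_iff.mp hij).ne'
      simp only [Fin.cases_succ, hvs]
      simp [hne]
  have hP0 : P 0 0 = 1 := by
    simp only [hP, Matrix.of_apply, Fin.cases_zero, he₀]
  have hPs : ∀ r : Fin q, P r.succ r.succ = t := by
    intro r
    simp only [hP, Matrix.of_apply, Fin.cases_succ, hvs]
    simp
  have hdet : P.det = t ^ q := by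
    rw [Matrix.det_of_upperTriangular hPtri, Fin.prod_univ_succ, hP0, one_mul]
    simp only [hPs, Finset.prod_const, Finset.card_univ, Fintype.card_fin]
  have hPunit : IsUnit P.det := by
    rw [hdet]
    exact isUnit_iff_ne_zero.mpr (pow_ne_zero q ht)
  -- `Rk(P Pᵀ) = q + 1`
  have hrankPP : (P * Pᵀ).rank = q + 1 := by
    rw [Matrix.rank_mul_eq_left_of_isUnit_det Pᵀ P (by rwa [Matrix.det_transpose]),
      Matrix.rank_of_isUnit P ((Matrix.isUnit_iff_isUnit_det P).mpr hPunit), Fintype.card_fin]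
  -- `Rk(β⁻¹ w wᵀ) ≤ 1`
  have hvv : (β⁻¹ • Matrix.vecMulVec w w).rank ≤ 1 := by
    rw [← Matrix.smul_vecMulVec]
    exact Matrix.rank_vecMulVec_le _ _
  -- conclude: `q + 1 = Rk(P Pᵀ) ≤ Rk(M) + Rk(β⁻¹ w wᵀ) ≤ Rk(M) + 1`
  have h1 : (P * Pᵀ).rank ≤ (Matrix.of fun r s : Fin (q + 1) => ∑ i : Fin (q + 2),
      Fin.append (fun _ : Fin q => (1 : L)) ![-β⁻¹, 1] i *
        Fin.append vs ![w, e₀] i r * Fin.append vs ![w, e₀] i s).rank + 1 := by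
    rw [← hfact]
    exact (rank_add_le₇₁ _ _).trans (Nat.add_le_add_left hvv _)
  rw [hrankPP] at h1
  omega

/-- **Alman–Li 2026, Lemma 7.1 as printed ("has rank `q`")**, coordinates over any field `L` with
`λ ↦ t`, `t ≠ 0` and `β = (1 − qt)² + qt² ≠ 0`: the matrix `M = ∑ᵢ cᵢ' vᵢ vᵢᵀ` of `lemma71_rank_le`
has rank exactly `q`. [cite: AlmanLi2026, Lemma 7.1] -/
theorem lemma71_rank_eq (q : ℕ) (t : L) (ht : t ≠ 0)
    (hβ : (1 - (q : L) * t) ^ 2 + (q : L) * t ^ 2 ≠ 0) :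
    (Matrix.of fun r s : Fin (q + 1) =>
      ∑ i : Fin (q + 2),
        Fin.append (fun _ : Fin q => (1 : L)) ![-((1 - (q : L) * t) ^ 2 + (q : L) * t ^ 2)⁻¹, 1] i *
          Fin.append (fun i : Fin q =>
              (Fin.cases 1 (fun r => if r = i then t else 0) : Fin (q + 1) → L))
            ![Fin.cases 1 (fun _ => t ^ 2), Fin.cases 1 (fun _ => 0)] i r *
          Fin.append (fun i : Fin q =>
              (Fin.cases 1 (fun r => if r = i then t else 0) : Fin (q + 1) → L))
            ![Fin.cases 1 (fun _ => t ^ 2), Fin.cases 1 (fun _ => 0)] i s).rank = q :=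
  le_antisymm (lemma71_rank_le q t hβ) (lemma71_rank_ge q t ht)

end AlmanLi2026

end Literature.Computability.AlgebraicComplexity
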